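import Summits.BirchSwinnertonDyer.BirchSwinnertonDyer.Theorems.ThetaPartnerAtTwoMazurTateCongruenceAtTwoRSymbolMuOfFlat
import Summits.BirchSwinnertonDyer.BirchSwinnertonDyer.Theorems.ResidualThetaTransportAtTwoThetaLayerLambdaCongruenceAtTwoNoMazurKenku
import HarnessLib

/-!
# Crux `MazurTateCongruenceAtTwoTop` (stmt-BirchSwinnertonDyer-25797 = `MazurTateCongruenceAtTwoR` 21416), line `symbol`:
# FOUR print facts, not six — the K1 chain re-threaded through the plus line as a hypothesis, then fed by
# `plusLineCharTwo_of_fourFacts` (Faltings and Mazur–Kenku dropped: the first is a tree THEOREM, the second unused)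
# (width seat bsd-wall-tp2-p1-w2 g2; TRANCHE ENTRY #2 of bsd-inputs-plan-1 g8; `--supports stmt-BirchSwinnertonDyer-25797`; closes nothing)

HONEST FRAMING. THEOREMS ONLY. The named Literature facts (`eichlerShimura_depletedOptimalQuotient_periodLattice_of_dvd`,
`heckeSelfDual_torsionBy_J0` / `periodHomology_exists_heckeSelfAdjoint_perfectPairing`, `buzzard2000_multiplicityOne_gamma0`,
`serre1972_supersingular_decompositionSubgroup_image`, `realPeriodRat_eq_unit_mul_plusPeriod_two` / `abbesUllmo_not_dvd_maninConstant_of_not_dvd_level`)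
and the research statements (`SignedMuAtTwo.CuspSpanEvenAtTwo`, (PR₂), FLAT, `Hμ`) are explicit HYPOTHESES; nothing about their truth is
asserted; BSD is not proved by any of this.

WHY. bsd-inputs-plan-1 g8 (HOME/bsd-inputs/STATUS.md 09:40:35Z): in the K1 chain the facts `isIsogenous_iff_frobeniusTrace_eq` (Faltings;
the tree THEOREM `isIsogenous_iff_frobeniusTrace_eq_holds`) and `mazurKenku_exists_cyclic_isogeny` (used only for a cyclic isogeny, tree
`IsIsogenous.exists_isCyclic`) are PASS-THROUGH: their sole use is `plusLineCharTwo_of_facts hES hF hMK hSD hBz hSe` inside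
`depletedParity_of_congruent_of_facts_anyRank` (`…ROfPlusLineAnyRank`), and route ResidualThetaTransportAtTwo's
`plusLineCharTwo_of_fourFacts (hES hSD hBz hSe)` (`…NoMazurKenku`, p618708) has the same conclusion. So:

* §1 `parity_cusps_of_congruent_of_plusLine_anyRank`, `mazurTateCongruence_of_plusLine`, `mazurTateCongruenceAtTwoTop_of_plusLine_mu` — the
  lead's `…RAssembly` §3–§4 with the six facts replaced by the mod-`2` PLUS-LINE statement as a hypothesis (proofs verbatim; `HΔ` discharged).
* §2 `mazurTateCongruenceAtTwoTop_of_fourFacts_mu` / `…_of_fourFacts_cuspSpan` / `…_of_fourFacts_undepletedMax` / `…_of_fourFacts_flat` —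
  THE CRUX BY NAME behind FOUR print facts {ES-depleted, SD, Bz, Se} + the period fact + ONE research node (in the currency `Hμ` /
  CuspSpanEvenAtTwo at odd levels / per-curve (PR₂) / FLAT); `…_of_fiveFacts_cuspSpan` / `…_of_fiveFacts_flat` — with the period fact from
  Abbes–Ullmo (`SkinnerUrban2014.realPeriodRat_eq_unit_mul_plusPeriod_two_fact_of_abbesUllmo`): **PUB⁵ = {ES-depleted, SD, Bz, Se, AU}**, the
  honest shared bundle of RTT's D-split; `…_of_fourFacts_pairing_cuspSpan` — SD from the integral pairing; 21416 twins.

References: [GreenbergVatsal2000] Thm. (1.4), §3 (13), Remark 3.4; [Vatsal1999] Thm. (1.13); [Buzzard2000LevelLoweringModTwo] Prop. 2.4;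
[Pollack2003] Conj. 6.3, Prop. 6.18; [AbbesUllmo1996] Thm. A; [DarmonDiamondTaylor1995] Prop. 2.11 (a).
-/

-- justification: the `Summit.BirchSwinnertonDyer.BirchSwinnertonDyer.…` path repeats a component (route-file convention)
set_option linter.dupNamespace false
set_option autoImplicit false

noncomputable section

open scoped Classical MatrixGroups ModularForm

open CongruenceSubgroup Polynomial WeierstrassCurve NumberField IsDedekindDomain
  Literature.NumberTheory.IwasawaTheory Literature.NumberTheory.EllipticCurves Literature.NumberTheory.EllipticCurves.ModularForms
  Literature.NumberTheory.EllipticCurves.Rank1Residual Literature.NumberTheory.EllipticCurves.GreenbergVatsal2000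
  Literature.NumberTheory.EllipticCurves.Sprung2017
  Summit.BirchSwinnertonDyer.Rank1Residual.Supersingular
  Summit.BirchSwinnertonDyer.BirchSwinnertonDyer.Theorems.ThetaLayerLambdaCongruenceAtTwo

namespace Summit.BirchSwinnertonDyer.BirchSwinnertonDyer.Theorems.MazurTateCongruenceAtTwoR

/-! ## §1. The K1 chain from the plus line as a hypothesis -/

section Cusps

variable {W : WeierstrassCurve ℚ} [W.IsElliptic] [W.IsGloballyMinimal] [NeZero (W.conductorNorm ℤ)]
  {A : WeierstrassCurve ℚ} [A.IsElliptic] [A.IsGloballyMinimal] [NeZero (A.conductorNorm ℤ)]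
  {f : CuspForm (Gamma0 (W.conductorNorm ℤ)) 2} {fA : CuspForm (Gamma0 (A.conductorNorm ℤ)) 2}

/-- **(PAR2) at the odd-numerator `2`-power cusps from the PLUS LINE (as a hypothesis) + trace congruence + `μ`** — the lead's
`parity_cusps_of_congruent_of_facts_anyRank` (`…RAssembly` §3) with the six named facts replaced by their only use, the mod-`2` plus-line
statement `hC3` (the conclusion of `plusLineAtTwoLevel_of_charTwoLevel`); proof verbatim. [cite: GreenbergVatsal2000, Thm. (1.4), §3 (13)]
[cite: Buzzard2000LevelLoweringModTwo, Prop. 2.4] -/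
theorem parity_cusps_of_congruent_of_plusLine_anyRank
    (hC3 : ∀ (W : WeierstrassCurve ℚ) [W.IsElliptic] [W.IsGloballyMinimal], Literature.NumberTheory.EllipticCurves.Rank1Residual.GoodSS W 2 → W.Δ < 0 → ∀ (N' : ℕ), Odd N' → ∀ {N : ℕ} [NeZero N] (f : CuspForm (CongruenceSubgroup.Gamma0 N) 2), Literature.NumberTheory.EllipticCurves.ModularForms.IsNewformOf W f → ∀ (S : Finset ℕ), (∀ ℓ ∈ S, ℓ.Prime) → S.Nonempty → N * ∏ ℓ ∈ S, ℓ ^ 2 ∣ N' → (∀ p : ℕ, p.Prime → p ∣ N' → p ∈ S) → (∀ v : IsDedekindDomain.HeightOneSpectrum (NumberField.RingOfIntegers ℚ), ¬ ((Rat.HeightOneSpectrum.primesEquiv v : ℕ) ∣ 2 * N') → W.HasGoodReductionAt v) → ∀ (Φ₁ Φ₂ : ℚ → PadicAlgCl 2), (∀ (r : ℚ) (z : ℤ), Φ₁ (r + z) = Φ₁ r) → (∀ r : ℚ, Φ₁ (-r) = Φ₁ r) → (∀ (γ : CongruenceSubgroup.Gamma0 (N')) (r : ℚ), ((γ : SL(2,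 ℤ)) 1 0 : ℚ) * r + ((γ : SL(2, ℤ)) 1 1 : ℚ) ≠ 0 → Φ₁ ((((γ : SL(2, ℤ)) 0 0 : ℚ) * r + ((γ : SL(2, ℤ)) 0 1 : ℚ)) / (((γ : SL(2, ℤ)) 1 0 : ℚ) * r + ((γ : SL(2, ℤ)) 1 1 : ℚ))) = (if ((γ : SL(2, ℤ)) 1 0) = 0 then 0 else Φ₁ ((((γ : SL(2, ℤ)) 0 0 : ℚ)) / (((γ : SL(2, ℤ)) 1 0 : ℚ)))) + Φ₁ r) → (∀ (r : ℚ) (z : ℤ), Φ₂ (r + z) = Φ₂ r) → (∀ r : ℚ, Φ₂ (-r) = Φ₂ r) → (∀ (γ : CongruenceSubgroup.Gamma0 (N')) (r : ℚ), ((γ : SL(2, ℤ)) 1 0 : ℚ) * r + ((γ : SL(2, ℤ)) 1 1 : ℚ) ≠ 0 → Φ₂ ((((γ : SL(2, ℤ)) 0 0 : ℚ) * r + ((γ : SL(2, ℤ)) 0 1 : ℚ)) / (((γ : SL(2, ℤ)) 1 0 : ℚ) * r + ((γ : SL(2, ℤ)) 1 1 : ℚ))) = (if ((γ : SL(2, ℤ))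 1 0) = 0 then 0 else Φ₂ ((((γ : SL(2, ℤ)) 0 0 : ℚ)) / (((γ : SL(2, ℤ)) 1 0 : ℚ)))) + Φ₂ r) → (∀ r : ℚ, ‖Φ₁ r‖ ≤ 1) → (∀ r : ℚ, ‖Φ₂ r‖ ≤ 1) → (∃ r : ℚ, ‖Φ₁ r‖ = 1) → (∃ r : ℚ, ‖Φ₂ r‖ = 1) → (∀ q : ℕ, q.Prime → ¬ q ∣ N' → ∀ r : ℚ, ‖(∑ j : Fin q, Φ₁ ((r + j) / q)) + Φ₁ (q * r) - (W.LFunction q : PadicAlgCl 2) * Φ₁ r‖ < 1) → (∀ q : ℕ, q.Prime → ¬ q ∣ N' → ∀ r : ℚ, ‖(∑ j : Fin q, Φ₂ ((r + j) / q)) + Φ₂ (q * r) - (W.LFunction q : PadicAlgCl 2) * Φ₂ r‖ < 1) → (∀ ℓ : ℕ, ℓ.Prime → ℓ ∣ N' → ∀ r : ℚ, ‖∑ j : Fin ℓ, Φ₁ ((r + j) / ℓ)‖ < 1) → (∀ ℓ : ℕ, ℓ.Prime → ℓ ∣ N' → ∀ r : ℚ, ‖∑ j : Fin ℓ, Φ₂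 ((r + j) / ℓ)‖ < 1) → ∃ a : PadicAlgCl 2, ∀ r : ℚ, ‖a * Φ₁ r - Φ₂ r‖ < 1)
    (hss : Literature.NumberTheory.EllipticCurves.Rank1Residual.GoodSS W 2) (hΔ : W.Δ < 0) (hf : IsNewformOf W f)
    (hssA : Literature.NumberTheory.EllipticCurves.Rank1Residual.GoodSS A 2) (hfA : IsNewformOf A fA)
    (hcong : ∀ q : ℕ, q.Prime → ¬ q ∣ W.conductorNorm ℤ → ¬ q ∣ A.conductorNorm ℤ →
      ‖(A.LFunction q : PadicAlgCl 2) - (W.LFunction q : PadicAlgCl 2)‖ < 1)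
    (S₀ : Finset (IsDedekindDomain.HeightOneSpectrum (NumberField.RingOfIntegers ℚ)))
    (hS2 : ∀ v ∈ S₀, ((2 : ℕ) : NumberField.RingOfIntegers ℚ) ∉ v.asIdeal)
    (hSW : ∀ v : IsDedekindDomain.HeightOneSpectrum (NumberField.RingOfIntegers ℚ), ¬ W.HasGoodReductionAt v → v ∈ S₀)
    (hSA : ∀ v : IsDedekindDomain.HeightOneSpectrum (NumberField.RingOfIntegers ℚ), ¬ A.HasGoodReductionAt v → v ∈ S₀)
    (ϖ ϖA : ℚ)
    (hμW : ∃ x₀ : ℚ, (∀ r : ℚ, ‖(∑ k ∈ Fintype.piFinset (fun _ : S₀ ↦ Finset.range 3), (∏ v : S₀, ((W.localPolynomialAt (v : IsDedekindDomain.HeightOneSpectrum (NumberField.RingOfIntegers ℚ))).map (Int.castRingHom (PadicAlgCl 2))).coeff (k v) * ((Rat.HeightOneSpectrum.natGenerator (v : IsDedekindDomain.HeightOneSpectrum (NumberField.RingOfIntegers ℚ)) : PadicAlgCl 2)⁻¹) ^ (k v)) * algebraMap ℚ (PadicAlgCl 2) (ratPlusSymbol f (r * ((∏ v : S₀, Rat.HeightOneSpectrum.natGenerator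 (v : IsDedekindDomain.HeightOneSpectrum (NumberField.RingOfIntegers ℚ)) ^ (k v) : ℕ) : ℚ))))‖ ≤ ‖(∑ k ∈ Fintype.piFinset (fun _ : S₀ ↦ Finset.range 3), (∏ v : S₀, ((W.localPolynomialAt (v : IsDedekindDomain.HeightOneSpectrum (NumberField.RingOfIntegers ℚ))).map (Int.castRingHom (PadicAlgCl 2))).coeff (k v) * ((Rat.HeightOneSpectrum.natGenerator (v : IsDedekindDomain.HeightOneSpectrum (NumberField.RingOfIntegers ℚ)) : PadicAlgCl 2)⁻¹) ^ (k v)) * algebraMap ℚ (PadicAlgCl 2) (ratPlusSymbol f (x₀ * ((∏ v : S₀, Rat.HeightOneSpectrum.natGenerator (v : IsDedekindDomain.HeightOneSpectrum (NumberField.RingOfIntegers ℚ)) ^ (k v) : ℕ) : ℚ))))‖) ∧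
      ‖algebraMap ℚ (PadicAlgCl 2) (2 * ϖ) * (∑ k ∈ Fintype.piFinset (fun _ : S₀ ↦ Finset.range 3), (∏ v : S₀, ((W.localPolynomialAt (v : IsDedekindDomain.HeightOneSpectrum (NumberField.RingOfIntegers ℚ))).map (Int.castRingHom (PadicAlgCl 2))).coeff (k v) * ((Rat.HeightOneSpectrum.natGenerator (v : IsDedekindDomain.HeightOneSpectrum (NumberField.RingOfIntegers ℚ)) : PadicAlgCl 2)⁻¹) ^ (k v)) * algebraMap ℚ (PadicAlgCl 2) (ratPlusSymbol f (x₀ * ((∏ v : S₀, Rat.HeightOneSpectrum.natGenerator (v : IsDedekindDomain.HeightOneSpectrum (NumberField.RingOfIntegers ℚ)) ^ (k v) : ℕ) : ℚ))))‖ = 1)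
    (hμA : ∃ x₀ : ℚ, (∀ r : ℚ, ‖(∑ k ∈ Fintype.piFinset (fun _ : S₀ ↦ Finset.range 3), (∏ v : S₀, ((A.localPolynomialAt (v : IsDedekindDomain.HeightOneSpectrum (NumberField.RingOfIntegers ℚ))).map (Int.castRingHom (PadicAlgCl 2))).coeff (k v) * ((Rat.HeightOneSpectrum.natGenerator (v : IsDedekindDomain.HeightOneSpectrum (NumberField.RingOfIntegers ℚ)) : PadicAlgCl 2)⁻¹) ^ (k v)) * algebraMap ℚ (PadicAlgCl 2) (ratPlusSymbol fA (r * ((∏ v : S₀, Rat.HeightOneSpectrum.natGenerator (v : IsDedekindDomain.HeightOneSpectrum (NumberField.RingOfIntegers ℚ)) ^ (k v) : ℕ) : ℚ))))‖ ≤ ‖(∑ k ∈ Fintype.piFinset (fun _ : S₀ ↦ Finset.range 3), (∏ v : S₀, ((A.localPolynomialAt (v : IsDedekindDomain.HeightOneSpectrum (NumberField.RingOfIntegers ℚ))).map (Int.castRingHom (PadicAlgCl 2))).coeff (k v) * ((Rat.HeightOneSpectrum.natGenerator (v : IsDedekindDomain.HeightOneSpectrum (NumberField.RingOfIntegers ℚ))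 : PadicAlgCl 2)⁻¹) ^ (k v)) * algebraMap ℚ (PadicAlgCl 2) (ratPlusSymbol fA (x₀ * ((∏ v : S₀, Rat.HeightOneSpectrum.natGenerator (v : IsDedekindDomain.HeightOneSpectrum (NumberField.RingOfIntegers ℚ)) ^ (k v) : ℕ) : ℚ))))‖) ∧
      ‖algebraMap ℚ (PadicAlgCl 2) (2 * ϖA) * (∑ k ∈ Fintype.piFinset (fun _ : S₀ ↦ Finset.range 3), (∏ v : S₀, ((A.localPolynomialAt (v : IsDedekindDomain.HeightOneSpectrum (NumberField.RingOfIntegers ℚ))).map (Int.castRingHom (PadicAlgCl 2))).coeff (k v) * ((Rat.HeightOneSpectrum.natGenerator (v : IsDedekindDomain.HeightOneSpectrum (NumberField.RingOfIntegers ℚ)) : PadicAlgCl 2)⁻¹) ^ (k v)) * algebraMap ℚ (PadicAlgCl 2) (ratPlusSymbol fA (x₀ * ((∏ v : S₀, Rat.HeightOneSpectrum.natGenerator (v : IsDedekindDomain.HeightOneSpectrum (NumberField.RingOfIntegers ℚ)) ^ (k v) : ℕ) : ℚ))))‖ = 1)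
    (n a : ℕ) (ha : Odd a) :
    ‖((2 * ϖ * eulerDepleteTableList W S₀.toList (ratPlusSymbol f) ((a : ℚ) / (2 : ℚ) ^ (n + 2)) : ℚ) : ℚ_[2]) -
        ((2 * ϖA * eulerDepleteTableList A S₀.toList (ratPlusSymbol fA) ((a : ℚ) / (2 : ℚ) ^ (n + 2)) : ℚ) : ℚ_[2])‖ ≤ ‖(2 : ℚ_[2])‖ := by
  have hAodd : Odd (A.conductorNorm ℤ) := by
    have h2A : ¬ 2 ∣ A.conductorNorm ℤ := by
      rw [A.dvd_conductorNorm_iff_not_hasGoodReductionAtPrime 2, not_not]; exact hssA.1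
    exact Nat.odd_iff.mpr (Nat.two_dvd_ne_zero.mp h2A)
  -- the odd numerator `a` is `± 5^F (mod 2^{n+2})`: move to the cusp `5^{s₀}/2^{n+2}`
  have ha2 : ¬ 2 ∣ a := fun h ↦ (Nat.not_even_iff_odd.mpr ha) (even_iff_two_dvd.mpr h)
  obtain ⟨ω, hω, haω⟩ := exists_sign_mul_cyclotomicGenerator_pow_eq ha2 n
  set F₀ : ℕ := (PadicInt.toZModPow n (frobeniusExponent 2 (a : ℤ_[2]))).val with hF₀
  set s₀ : ZMod (2 ^ n) := (F₀ : ZMod (2 ^ n)) with hs₀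
  have hs₀v : s₀.val = F₀ % 2 ^ n := ZMod.val_natCast (2 ^ n) F₀
  haveI : Fact (1 < 2 ^ (n + 2)) := ⟨Nat.one_lt_two_pow (by omega)⟩
  have hxa : ∀ ψ : ℚ → ℚ, (∀ x, ψ (-x) = ψ x) → (∀ (x : ℚ) (z : ℤ), ψ (x + z) = ψ x) →
      ψ ((a : ℚ) / (2 : ℚ) ^ (n + 2)) = ψ ((((cyclotomicGenerator 2 : ZMod (2 ^ (n + 2))) ^ s₀.val).val : ℚ) / (2 : ℚ) ^ (n + 2)) := by
    intro ψ hneg hper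
    have h := apply_mul_cyclotomicGenerator_pow_val_div ψ hneg hper hω haω 0
    rw [pow_zero, ZMod.val_one, zero_add, Nat.cast_one, ← mul_div_assoc, mul_one] at h
    rw [h, hs₀v, ← cyclotomicGenerator_two_pow_eq_pow_mod]
  have hlW := hxa _ (eulerDepleteTableList_neg W S₀.toList (ratPlusSymbol_neg f))
    (eulerDepleteTableList_add_intCast' W S₀.toList (ratPlusSymbol_add_intCast_eq f))
  have hlA := hxa _ (eulerDepleteTableList_neg A S₀.toList (ratPlusSymbol_neg fA))
    (eulerDepleteTableList_add_intCast' A S₀.toList (ratPlusSymbol_add_intCast_eq fA))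
  rw [hlW, hlA, ← expandedTable_cusp_eq_eulerDepleteTableList W f S₀ hS2 n s₀,
    ← expandedTable_cusp_eq_eulerDepleteTableList A fA S₀ hS2 n s₀]
  -- the bridge at `r = 5^{s₀}/2^{n+2}`, read through `ℚ → ℚ₂ → ℚ̄₂`
  have hB := depletedParity_of_congruent_of_plusLine_anyRank hC3 hss hΔ hf hAodd hfA hcong S₀ hS2 hSW hSA
    ϖ ϖA hμW hμA ((((cyclotomicGenerator 2 : ZMod (2 ^ (n + 2))) ^ s₀.val).val : ℚ) / (2 : ℚ) ^ (n + 2))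
  rw [expandedTable_eq_algebraMap W f S₀ (PadicAlgCl 2), expandedTable_eq_algebraMap A fA S₀ (PadicAlgCl 2),
    ← map_mul, ← map_mul, ← map_sub] at hB
  have hcastq : ∀ q : ℚ, algebraMap ℚ (PadicAlgCl 2) q = algebraMap ℚ_[2] (PadicAlgCl 2) (q : ℚ_[2]) := by
    intro q; rw [map_ratCast, eq_ratCast]
  rw [hcastq, PadicAlgCl.norm_extends (p := 2)] at hB
  push_cast at hB ⊢
  -- a `ℚ₂`-norm `< 1` is `≤ ‖2‖`
  have h := (Padic.norm_le_pow_iff_norm_lt_pow_add_one _ (-1)).mpr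
    (by rw [show (-1 : ℤ) + 1 = 0 from by norm_num, zpow_zero]; exact hB)
  have h2n : ‖(2 : ℚ_[2])‖ = (2 : ℝ)⁻¹ := by
    have h' := Padic.norm_p (p := 2); exact_mod_cast h'
  have h3 : ((2 : ℕ) : ℝ) ^ (-1 : ℤ) = (2 : ℝ)⁻¹ := by norm_num
  rw [h2n, ← h3]
  convert h using 2


end Cusps

section Assembly

variable (W : WeierstrassCurve ℚ) [W.IsElliptic] [W.IsGloballyMinimal] (A : WeierstrassCurve ℚ) [A.IsElliptic]
  [A.IsGloballyMinimal]

/-- **One-socket assembly from the PLUS LINE (as a hypothesis).** The lead's `mazurTateCongruence_of_facts` with the six named facts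
replaced by the plus-line statement `hC3`; proof verbatim. [cite: GreenbergVatsal2000, Thm. (1.4), §3 (13)] [cite: Vatsal1999, Thm. (1.13)] -/
theorem mazurTateCongruence_of_plusLine
    (hC3 : ∀ (W : WeierstrassCurve ℚ) [W.IsElliptic] [W.IsGloballyMinimal], Literature.NumberTheory.EllipticCurves.Rank1Residual.GoodSS W 2 → W.Δ < 0 → ∀ (N' : ℕ), Odd N' → ∀ {N : ℕ} [NeZero N] (f : CuspForm (CongruenceSubgroup.Gamma0 N) 2), Literature.NumberTheory.EllipticCurves.ModularForms.IsNewformOf W f → ∀ (S : Finset ℕ), (∀ ℓ ∈ S, ℓ.Prime) → S.Nonempty → N * ∏ ℓ ∈ S, ℓ ^ 2 ∣ N' → (∀ p : ℕ, p.Prime → p ∣ N' → p ∈ S) → (∀ v : IsDedekindDomain.HeightOneSpectrum (NumberField.RingOfIntegers ℚ), ¬ ((Rat.HeightOneSpectrum.primesEquiv v : ℕ) ∣ 2 * N') → W.HasGoodReductionAt v) → ∀ (Φ₁ Φ₂ : ℚ → PadicAlgCl 2), (∀ (r : ℚ) (z : ℤ), Φ₁ (r + z) = Φ₁ r) → (∀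 r : ℚ, Φ₁ (-r) = Φ₁ r) → (∀ (γ : CongruenceSubgroup.Gamma0 (N')) (r : ℚ), ((γ : SL(2, ℤ)) 1 0 : ℚ) * r + ((γ : SL(2, ℤ)) 1 1 : ℚ) ≠ 0 → Φ₁ ((((γ : SL(2, ℤ)) 0 0 : ℚ) * r + ((γ : SL(2, ℤ)) 0 1 : ℚ)) / (((γ : SL(2, ℤ)) 1 0 : ℚ) * r + ((γ : SL(2, ℤ)) 1 1 : ℚ))) = (if ((γ : SL(2, ℤ)) 1 0) = 0 then 0 else Φ₁ ((((γ : SL(2, ℤ)) 0 0 : ℚ)) / (((γ : SL(2, ℤ)) 1 0 : ℚ)))) + Φ₁ r) → (∀ (r : ℚ) (z : ℤ), Φ₂ (r + z) = Φ₂ r) → (∀ r : ℚ, Φ₂ (-r) = Φ₂ r) → (∀ (γ : CongruenceSubgroup.Gamma0 (N')) (r : ℚ), ((γ : SL(2, ℤ)) 1 0 : ℚ) * r + ((γ : SL(2, ℤ)) 1 1 : ℚ) ≠ 0 → Φ₂ ((((γ : SL(2, ℤ)) 0 0 : ℚ) * r + ((γ : SL(2, ℤ)) 0 1 : ℚ))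 / (((γ : SL(2, ℤ)) 1 0 : ℚ) * r + ((γ : SL(2, ℤ)) 1 1 : ℚ))) = (if ((γ : SL(2, ℤ)) 1 0) = 0 then 0 else Φ₂ ((((γ : SL(2, ℤ)) 0 0 : ℚ)) / (((γ : SL(2, ℤ)) 1 0 : ℚ)))) + Φ₂ r) → (∀ r : ℚ, ‖Φ₁ r‖ ≤ 1) → (∀ r : ℚ, ‖Φ₂ r‖ ≤ 1) → (∃ r : ℚ, ‖Φ₁ r‖ = 1) → (∃ r : ℚ, ‖Φ₂ r‖ = 1) → (∀ q : ℕ, q.Prime → ¬ q ∣ N' → ∀ r : ℚ, ‖(∑ j : Fin q, Φ₁ ((r + j) / q)) + Φ₁ (q * r) - (W.LFunction q : PadicAlgCl 2) * Φ₁ r‖ < 1) → (∀ q : ℕ, q.Prime → ¬ q ∣ N' → ∀ r : ℚ, ‖(∑ j : Fin q, Φ₂ ((r + j) / q)) + Φ₂ (q * r) - (W.LFunction q : PadicAlgCl 2) * Φ₂ r‖ < 1) → (∀ ℓ : ℕ, ℓ.Prime → ℓ ∣ N' → ∀ r : ℚ, ‖∑ j : Fin ℓ, Φ₁ ((r + j)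 / ℓ)‖ < 1) → (∀ ℓ : ℕ, ℓ.Prime → ℓ ∣ N' → ∀ r : ℚ, ‖∑ j : Fin ℓ, Φ₂ ((r + j) / ℓ)‖ < 1) → ∃ a : PadicAlgCl 2, ∀ r : ℚ, ‖a * Φ₁ r - Φ₂ r‖ < 1)
    (hss : GoodSS W 2) (hΔ : W.Δ < 0) (hssA : GoodSS A 2)
    (he : ∃ e : geomTorsion W (2 : ℤ) ≃+ geomTorsion A (2 : ℤ),
      ∀ (σ : Field.absoluteGaloisGroup ℚ) (P : geomTorsion W (2 : ℤ)), e (σ • P) = σ • e P)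
    [NeZero (W.conductorNorm ℤ)] (f : CuspForm (Gamma0 (W.conductorNorm ℤ)) 2) (hf : IsNewformOf W f) (ϖ : ℚ)
    {Lplus Lminus : IwasawaAlgebra 2} (hPP : IsPollackPair f 2 Lplus Lminus)
    [NeZero (A.conductorNorm ℤ)] (fA : CuspForm (Gamma0 (A.conductorNorm ℤ)) 2) (hfA : IsNewformOf A fA) (ϖA : ℚ)
    {LplusA LminusA : IwasawaAlgebra 2} (hPPA : IsPollackPair fA 2 LplusA LminusA)
    (S₀ : Finset (HeightOneSpectrum (𝓞 ℚ))) (hS2 : ∀ v ∈ S₀, ((2 : ℕ) : 𝓞 ℚ) ∉ v.asIdeal)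
    (hSW : ∀ v : HeightOneSpectrum (𝓞 ℚ), ¬ W.HasGoodReductionAt v → v ∈ S₀)
    (hSA : ∀ v : HeightOneSpectrum (𝓞 ℚ), ¬ A.HasGoodReductionAt v → v ∈ S₀)
    (hμW : (∃ x₀ : ℚ, (∀ r : ℚ, ‖(∑ k ∈ Fintype.piFinset (fun _ : S₀ ↦ Finset.range 3), (∏ v : S₀, ((W.localPolynomialAt (v : HeightOneSpectrum (𝓞 ℚ))).map (Int.castRingHom (PadicAlgCl 2))).coeff (k v) * ((Rat.HeightOneSpectrum.natGenerator (v : HeightOneSpectrum (𝓞 ℚ)) : PadicAlgCl 2)⁻¹) ^ (k v)) * algebraMap ℚ (PadicAlgCl 2) (ratPlusSymbol f (r * ((∏ v : S₀, Rat.HeightOneSpectrum.natGenerator (v : HeightOneSpectrum (𝓞 ℚ)) ^ (k v) : ℕ) : ℚ))))‖ ≤ ‖(∑ k ∈ Fintype.piFinset (fun _ : S₀ ↦ Finset.range 3), (∏ v : S₀, ((W.localPolynomialAt (v : HeightOneSpectrum (𝓞 ℚ))).map (Int.castRingHom (PadicAlgCl 2))).coeff (k v) * ((Rat.HeightOneSpectrum.natGenerator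 (v : HeightOneSpectrum (𝓞 ℚ)) : PadicAlgCl 2)⁻¹) ^ (k v)) * algebraMap ℚ (PadicAlgCl 2) (ratPlusSymbol f (x₀ * ((∏ v : S₀, Rat.HeightOneSpectrum.natGenerator (v : HeightOneSpectrum (𝓞 ℚ)) ^ (k v) : ℕ) : ℚ))))‖) ∧
      ‖algebraMap ℚ (PadicAlgCl 2) (2 * ϖ) * (∑ k ∈ Fintype.piFinset (fun _ : S₀ ↦ Finset.range 3), (∏ v : S₀, ((W.localPolynomialAt (v : HeightOneSpectrum (𝓞 ℚ))).map (Int.castRingHom (PadicAlgCl 2))).coeff (k v) * ((Rat.HeightOneSpectrum.natGenerator (v : HeightOneSpectrum (𝓞 ℚ)) : PadicAlgCl 2)⁻¹) ^ (k v)) * algebraMap ℚ (PadicAlgCl 2) (ratPlusSymbol f (x₀ * ((∏ v : S₀, Rat.HeightOneSpectrum.natGenerator (v : HeightOneSpectrum (𝓞 ℚ)) ^ (k v) : ℕ) : ℚ))))‖ = 1))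
    (hμA : (∃ x₀ : ℚ, (∀ r : ℚ, ‖(∑ k ∈ Fintype.piFinset (fun _ : S₀ ↦ Finset.range 3), (∏ v : S₀, ((A.localPolynomialAt (v : HeightOneSpectrum (𝓞 ℚ))).map (Int.castRingHom (PadicAlgCl 2))).coeff (k v) * ((Rat.HeightOneSpectrum.natGenerator (v : HeightOneSpectrum (𝓞 ℚ)) : PadicAlgCl 2)⁻¹) ^ (k v)) * algebraMap ℚ (PadicAlgCl 2) (ratPlusSymbol fA (r * ((∏ v : S₀, Rat.HeightOneSpectrum.natGenerator (v : HeightOneSpectrum (𝓞 ℚ)) ^ (k v) : ℕ) : ℚ))))‖ ≤ ‖(∑ k ∈ Fintype.piFinset (fun _ : S₀ ↦ Finset.range 3), (∏ v : S₀, ((A.localPolynomialAt (v : HeightOneSpectrum (𝓞 ℚ))).map (Int.castRingHom (PadicAlgCl 2))).coeff (k v) * ((Rat.HeightOneSpectrum.natGenerator (v : HeightOneSpectrum (𝓞 ℚ)) : PadicAlgCl 2)⁻¹) ^ (k v)) * algebraMap ℚ (PadicAlgCl 2) (ratPlusSymbol fA (x₀ * ((∏ v : S₀, Rat.HeightOneSpectrum.natGenerator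 (v : HeightOneSpectrum (𝓞 ℚ)) ^ (k v) : ℕ) : ℚ))))‖) ∧
      ‖algebraMap ℚ (PadicAlgCl 2) (2 * ϖA) * (∑ k ∈ Fintype.piFinset (fun _ : S₀ ↦ Finset.range 3), (∏ v : S₀, ((A.localPolynomialAt (v : HeightOneSpectrum (𝓞 ℚ))).map (Int.castRingHom (PadicAlgCl 2))).coeff (k v) * ((Rat.HeightOneSpectrum.natGenerator (v : HeightOneSpectrum (𝓞 ℚ)) : PadicAlgCl 2)⁻¹) ^ (k v)) * algebraMap ℚ (PadicAlgCl 2) (ratPlusSymbol fA (x₀ * ((∏ v : S₀, Rat.HeightOneSpectrum.natGenerator (v : HeightOneSpectrum (𝓞 ℚ)) ^ (k v) : ℕ) : ℚ))))‖ = 1))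
    {G GA : IwasawaAlgebra 2} {m m' : ℕ}
    (hG : iwasawaToPowerSeries 2 G =
      PowerSeries.C ((2 : ℚ_[2]) ^ m * (ϖ : ℚ_[2])) * iwasawaToPowerSeries 2 (kobayashiL 1 Lplus Lminus))
    (hGA : iwasawaToPowerSeries 2 GA =
      PowerSeries.C ((2 : ℚ_[2]) ^ m' * (ϖA : ℚ_[2])) * iwasawaToPowerSeries 2 (kobayashiL 1 LplusA LminusA)) :
    ∃ u : ℤ_[2]ˣ, ∀ n : ℕ, Even n → ∃ q r : IwasawaAlgebra 2,
      PowerSeries.C (((2 : ℤ_[2]) ^ m' : ℤ_[2]) : ℚ_[2]) *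
            (PowerSeries.C ((2 : ℚ_[2]) ^ m * (ϖ : ℚ_[2])) *
              ((mazurTateElement f 2 n).map (algebraMap ℚ ℚ_[2]) : PowerSeries ℚ_[2]) *
              iwasawaToPowerSeries 2 (eulerFactorProductInv W 2 S₀)) -
          PowerSeries.C (((u : ℤ_[2]) * (2 : ℤ_[2]) ^ m : ℤ_[2]) : ℚ_[2]) *
            (PowerSeries.C ((2 : ℚ_[2]) ^ m' * (ϖA : ℚ_[2])) *
              ((mazurTateElement fA 2 n).map (algebraMap ℚ ℚ_[2]) : PowerSeries ℚ_[2]) *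
              iwasawaToPowerSeries 2 (eulerFactorProductInv A 2 S₀)) =
        iwasawaToPowerSeries 2 (PowerSeries.C ((2 : ℤ_[2]) ^ (m + m' + 1)) * q + Sprung2017.toIwasawa 2 (cyclotomicOmega 2 n) * r) := by
  obtain ⟨e, he'⟩ := he
  have hcong : ∀ q : ℕ, q.Prime → ¬ q ∣ W.conductorNorm ℤ → ¬ q ∣ A.conductorNorm ℤ →
      ‖(A.LFunction q : PadicAlgCl 2) - (W.LFunction q : PadicAlgCl 2)‖ < 1 :=
    fun q hq hW hA ↦ norm_LFunction_sub_lt_one_of_equiv W A e he' hss hssA hq hW hA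
  refine ⟨1, fun n hn ↦ layerCongruence_of_symbolBound W A f fA hPP hPPA hG hGA S₀ hS2 1 hn fun a ha ↦ ?_⟩
  exact norm_sub_le_one_of_parity _ _ _ _ (parity_cusps_of_congruent_of_plusLine_anyRank hC3 hss hΔ hf hssA
    hfA hcong S₀ hS2 hSW hSA ϖ ϖA hμW hμA n a ha)

end Assembly

section Crux

/-- **The crux BY NAME from the PLUS LINE (as a hypothesis) + the symbol-`μ` statement `Hμ`** (`HΔ` discharged by
`ThetaPartnerXRoute.Δ_neg_of_cmPartner_two`). [cite: GreenbergVatsal2000, Thm. (1.4), §3 (13)] [cite: Vatsal1999, Thm. (1.13)] -/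
theorem mazurTateCongruenceAtTwoTop_of_plusLine_mu
    (hC3 : ∀ (W : WeierstrassCurve ℚ) [W.IsElliptic] [W.IsGloballyMinimal], Literature.NumberTheory.EllipticCurves.Rank1Residual.GoodSS W 2 → W.Δ < 0 → ∀ (N' : ℕ), Odd N' → ∀ {N : ℕ} [NeZero N] (f : CuspForm (CongruenceSubgroup.Gamma0 N) 2), Literature.NumberTheory.EllipticCurves.ModularForms.IsNewformOf W f → ∀ (S : Finset ℕ), (∀ ℓ ∈ S, ℓ.Prime) → S.Nonempty → N * ∏ ℓ ∈ S, ℓ ^ 2 ∣ N' → (∀ p : ℕ, p.Prime → p ∣ N' → p ∈ S) → (∀ v : IsDedekindDomain.HeightOneSpectrum (NumberField.RingOfIntegers ℚ), ¬ ((Rat.HeightOneSpectrum.primesEquiv v : ℕ) ∣ 2 * N') → W.HasGoodReductionAt v) → ∀ (Φ₁ Φ₂ : ℚ → PadicAlgCl 2), (∀ (r : ℚ) (z : ℤ), Φ₁ (r + z) = Φ₁ r) → (∀ r : ℚ, Φ₁ (-r) = Φ₁ r) → (∀ (γ : CongruenceSubgroup.Gamma0 (N')) (r : ℚ), ((γ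 : SL(2, ℤ)) 1 0 : ℚ) * r + ((γ : SL(2, ℤ)) 1 1 : ℚ) ≠ 0 → Φ₁ ((((γ : SL(2, ℤ)) 0 0 : ℚ) * r + ((γ : SL(2, ℤ)) 0 1 : ℚ)) / (((γ : SL(2, ℤ)) 1 0 : ℚ) * r + ((γ : SL(2, ℤ)) 1 1 : ℚ))) = (if ((γ : SL(2, ℤ)) 1 0) = 0 then 0 else Φ₁ ((((γ : SL(2, ℤ)) 0 0 : ℚ)) / (((γ : SL(2, ℤ)) 1 0 : ℚ)))) + Φ₁ r) → (∀ (r : ℚ) (z : ℤ), Φ₂ (r + z) = Φ₂ r) → (∀ r : ℚ, Φ₂ (-r) = Φ₂ r) → (∀ (γ : CongruenceSubgroup.Gamma0 (N')) (r : ℚ), ((γ : SL(2, ℤ)) 1 0 : ℚ) * r + ((γ : SL(2, ℤ)) 1 1 : ℚ) ≠ 0 → Φ₂ ((((γ : SL(2, ℤ)) 0 0 : ℚ) * r + ((γ : SL(2, ℤ)) 0 1 : ℚ)) / (((γ : SL(2, ℤ)) 1 0 : ℚ) * r + ((γ : SL(2, ℤ)) 1 1 : ℚ))) = (if ((γ :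 SL(2, ℤ)) 1 0) = 0 then 0 else Φ₂ ((((γ : SL(2, ℤ)) 0 0 : ℚ)) / (((γ : SL(2, ℤ)) 1 0 : ℚ)))) + Φ₂ r) → (∀ r : ℚ, ‖Φ₁ r‖ ≤ 1) → (∀ r : ℚ, ‖Φ₂ r‖ ≤ 1) → (∃ r : ℚ, ‖Φ₁ r‖ = 1) → (∃ r : ℚ, ‖Φ₂ r‖ = 1) → (∀ q : ℕ, q.Prime → ¬ q ∣ N' → ∀ r : ℚ, ‖(∑ j : Fin q, Φ₁ ((r + j) / q)) + Φ₁ (q * r) - (W.LFunction q : PadicAlgCl 2) * Φ₁ r‖ < 1) → (∀ q : ℕ, q.Prime → ¬ q ∣ N' → ∀ r : ℚ, ‖(∑ j : Fin q, Φ₂ ((r + j) / q)) + Φ₂ (q * r) - (W.LFunction q : PadicAlgCl 2) * Φ₂ r‖ < 1) → (∀ ℓ : ℕ, ℓ.Prime → ℓ ∣ N' → ∀ r : ℚ, ‖∑ j : Fin ℓ, Φ₁ ((r + j) / ℓ)‖ < 1) → (∀ ℓ : ℕ, ℓ.Prime → ℓ ∣ N' → ∀ r : ℚ, ‖∑ j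 : Fin ℓ, Φ₂ ((r + j) / ℓ)‖ < 1) → ∃ a : PadicAlgCl 2, ∀ r : ℚ, ‖a * Φ₁ r - Φ₂ r‖ < 1)
    (Hμ : ∀ (E : WeierstrassCurve ℚ) [E.IsElliptic] [E.IsGloballyMinimal], GoodSS E 2 → E.frobeniusTrace 2 = 0 →
      ∀ [NeZero (E.conductorNorm ℤ)] (f : CuspForm (Gamma0 (E.conductorNorm ℤ)) 2), IsNewformOf E f →
      ∀ (ϖ : ℚ), (ϖ : ℝ) * E.realPeriodRat = plusPeriod f →
      ∀ (S₀ : Finset (HeightOneSpectrum (𝓞 ℚ))), (∀ v ∈ S₀, ((2 : ℕ) : 𝓞 ℚ) ∉ v.asIdeal) →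
        (∀ v : HeightOneSpectrum (𝓞 ℚ), ¬ E.HasGoodReductionAt v → v ∈ S₀) →
      ∃ x₀ : ℚ, (∀ r : ℚ, ‖(∑ k ∈ Fintype.piFinset (fun _ : S₀ ↦ Finset.range 3), (∏ v : S₀, ((E.localPolynomialAt (v : HeightOneSpectrum (𝓞 ℚ))).map (Int.castRingHom (PadicAlgCl 2))).coeff (k v) * ((Rat.HeightOneSpectrum.natGenerator (v : HeightOneSpectrum (𝓞 ℚ)) : PadicAlgCl 2)⁻¹) ^ (k v)) * algebraMap ℚ (PadicAlgCl 2) (ratPlusSymbol f (r * ((∏ v : S₀, Rat.HeightOneSpectrum.natGenerator (v : HeightOneSpectrum (𝓞 ℚ)) ^ (k v) : ℕ) : ℚ))))‖ ≤ ‖(∑ k ∈ Fintype.piFinset (fun _ : S₀ ↦ Finset.range 3), (∏ v : S₀, ((E.localPolynomialAt (v : HeightOneSpectrum (𝓞 ℚ))).map (Int.castRingHom (PadicAlgCl 2))).coeff (k v) * ((Rat.HeightOneSpectrum.natGenerator (v : HeightOneSpectrum (𝓞 ℚ)) : PadicAlgCl 2)⁻¹) ^ (k v)) * algebraMap ℚ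 (PadicAlgCl 2) (ratPlusSymbol f (x₀ * ((∏ v : S₀, Rat.HeightOneSpectrum.natGenerator (v : HeightOneSpectrum (𝓞 ℚ)) ^ (k v) : ℕ) : ℚ))))‖) ∧
        ‖algebraMap ℚ (PadicAlgCl 2) (2 * ϖ) * (∑ k ∈ Fintype.piFinset (fun _ : S₀ ↦ Finset.range 3), (∏ v : S₀, ((E.localPolynomialAt (v : HeightOneSpectrum (𝓞 ℚ))).map (Int.castRingHom (PadicAlgCl 2))).coeff (k v) * ((Rat.HeightOneSpectrum.natGenerator (v : HeightOneSpectrum (𝓞 ℚ)) : PadicAlgCl 2)⁻¹) ^ (k v)) * algebraMap ℚ (PadicAlgCl 2) (ratPlusSymbol f (x₀ * ((∏ v : S₀, Rat.HeightOneSpectrum.natGenerator (v : HeightOneSpectrum (𝓞 ℚ)) ^ (k v) : ℕ) : ℚ))))‖ = 1) :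
    Summit.BirchSwinnertonDyer.BirchSwinnertonDyer.Theses.ThetaPartnerAtTwo.MazurTateCongruenceAtTwoTop := by
  intro W _ _ A _ _ _ _ hss ha hAcm hAss hAa he γ _hγ _ f hf ϖ hϖ Lplus Lminus hPP _ fA hfA ϖA hϖA LplusA LminusA hPPA
    S₀ hS2 hSW hSA G m hG GA m' hGA
  have hΔ : W.Δ < 0 := by
    obtain ⟨e, he'⟩ := he
    exact ThetaPartnerXRoute.Δ_neg_of_cmPartner_two W A hAcm hAss e he'
  exact mazurTateCongruence_of_plusLine W A hC3 hss hΔ hAss he f hf ϖ hPP fA hfA ϖA hPPA S₀ hS2 hSW hSA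
    (Hμ W hss ha f hf ϖ hϖ S₀ hS2 hSW) (Hμ A hAss hAa fA hfA ϖA hϖA S₀ hS2 hSA) hG hGA


/-! ## §2. FOUR print facts: Eichler–Shimura (depleted optimal quotient), Hecke self-duality, Buzzard, Serre 1972 -/

/-- **The crux BY NAME behind FOUR named facts + the symbol-`μ` statement `Hμ`.** The plus line from
`plusLineCharTwo_of_fourFacts (hES hSD hBz hSe)` (route ResidualThetaTransportAtTwo, `…NoMazurKenku`) through
`plusLineAtTwoLevel_of_charTwoLevel`; no Faltings, no Mazur–Kenku. [cite: Buzzard2000LevelLoweringModTwo, Prop. 2.4]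
[cite: GreenbergVatsal2000, Thm. (1.4), §3 (13)] -/
theorem mazurTateCongruenceAtTwoTop_of_fourFacts_mu
    (hES : eichlerShimura_depletedOptimalQuotient_periodLattice_of_dvd) (hSD : heckeSelfDual_torsionBy_J0)
    (hBz : buzzard2000_multiplicityOne_gamma0) (hSe : serre1972_supersingular_decompositionSubgroup_image)
    (Hμ : ∀ (E : WeierstrassCurve ℚ) [E.IsElliptic] [E.IsGloballyMinimal], GoodSS E 2 → E.frobeniusTrace 2 = 0 →
      ∀ [NeZero (E.conductorNorm ℤ)] (f : CuspForm (Gamma0 (E.conductorNorm ℤ)) 2), IsNewformOf E f →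
      ∀ (ϖ : ℚ), (ϖ : ℝ) * E.realPeriodRat = plusPeriod f →
      ∀ (S₀ : Finset (HeightOneSpectrum (𝓞 ℚ))), (∀ v ∈ S₀, ((2 : ℕ) : 𝓞 ℚ) ∉ v.asIdeal) →
        (∀ v : HeightOneSpectrum (𝓞 ℚ), ¬ E.HasGoodReductionAt v → v ∈ S₀) →
      ∃ x₀ : ℚ, (∀ r : ℚ, ‖(∑ k ∈ Fintype.piFinset (fun _ : S₀ ↦ Finset.range 3), (∏ v : S₀, ((E.localPolynomialAt (v : HeightOneSpectrum (𝓞 ℚ))).map (Int.castRingHom (PadicAlgCl 2))).coeff (k v) * ((Rat.HeightOneSpectrum.natGenerator (v : HeightOneSpectrum (𝓞 ℚ)) : PadicAlgCl 2)⁻¹) ^ (k v)) * algebraMap ℚ (PadicAlgCl 2) (ratPlusSymbol f (r * ((∏ v : S₀, Rat.HeightOneSpectrum.natGenerator (v : HeightOneSpectrum (𝓞 ℚ)) ^ (k v) : ℕ) : ℚ))))‖ ≤ ‖(∑ k ∈ Fintype.piFinset (fun _ : S₀ ↦ Finset.range 3), (∏ v : S₀, ((E.localPolynomialAt (v : HeightOneSpectrum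 (𝓞 ℚ))).map (Int.castRingHom (PadicAlgCl 2))).coeff (k v) * ((Rat.HeightOneSpectrum.natGenerator (v : HeightOneSpectrum (𝓞 ℚ)) : PadicAlgCl 2)⁻¹) ^ (k v)) * algebraMap ℚ (PadicAlgCl 2) (ratPlusSymbol f (x₀ * ((∏ v : S₀, Rat.HeightOneSpectrum.natGenerator (v : HeightOneSpectrum (𝓞 ℚ)) ^ (k v) : ℕ) : ℚ))))‖) ∧
        ‖algebraMap ℚ (PadicAlgCl 2) (2 * ϖ) * (∑ k ∈ Fintype.piFinset (fun _ : S₀ ↦ Finset.range 3), (∏ v : S₀, ((E.localPolynomialAt (v : HeightOneSpectrum (𝓞 ℚ))).map (Int.castRingHom (PadicAlgCl 2))).coeff (k v) * ((Rat.HeightOneSpectrum.natGenerator (v : HeightOneSpectrum (𝓞 ℚ)) : PadicAlgCl 2)⁻¹) ^ (k v)) * algebraMap ℚ (PadicAlgCl 2) (ratPlusSymbol f (x₀ * ((∏ v : S₀, Rat.HeightOneSpectrum.natGenerator (v : HeightOneSpectrum (𝓞 ℚ)) ^ (k v) : ℕ) : ℚ))))‖ = 1) :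
    Summit.BirchSwinnertonDyer.BirchSwinnertonDyer.Theses.ThetaPartnerAtTwo.MazurTateCongruenceAtTwoTop :=
  mazurTateCongruenceAtTwoTop_of_plusLine_mu (plusLineAtTwoLevel_of_charTwoLevel (plusLineCharTwo_of_fourFacts hES hSD hBz hSe)) Hμ

/-- **THE CRUX BY NAME behind FOUR print facts + the period fact + «`∀ N` odd, `CuspSpanEvenAtTwo N`»** — the `closes` binder shape of
skeleton `symbol` v2 with `stub_pubPlusLineFacts` shrunk from six conjuncts to four. BSD is not proved by this.
[cite: Buzzard2000LevelLoweringModTwo, Prop. 2.4] [cite: Pollack2003, Conj. 6.3] [cite: GreenbergVatsal2000, Thm. (1.4), §3 (13) and Remark 3.4] -/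
theorem mazurTateCongruenceAtTwoTop_of_fourFacts_cuspSpan
    (hES : eichlerShimura_depletedOptimalQuotient_periodLattice_of_dvd) (hSD : heckeSelfDual_torsionBy_J0)
    (hBz : buzzard2000_multiplicityOne_gamma0) (hSe : serre1972_supersingular_decompositionSubgroup_image)
    (h2 : realPeriodRat_eq_unit_mul_plusPeriod_two)
    (hG : ∀ (N : ℕ) [NeZero N], ¬ 2 ∣ N → SignedMuAtTwo.CuspSpanEvenAtTwo N) :
    Summit.BirchSwinnertonDyer.BirchSwinnertonDyer.Theses.ThetaPartnerAtTwo.MazurTateCongruenceAtTwoTop :=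
  mazurTateCongruenceAtTwoTop_of_fourFacts_mu hES hSD hBz hSe (symbolMu_of_forall_cuspSpanEvenAtTwo h2 hG)

/-- **THE CRUX BY NAME behind PUB⁵ = {ES-depleted, SD, Bz, Se, AU} + «`∀ N` odd, `CuspSpanEvenAtTwo N`»** — the honest shared print bundle
of the two routes (the period fact from Abbes–Ullmo Thm. A by `SkinnerUrban2014.realPeriodRat_eq_unit_mul_plusPeriod_two_fact_of_abbesUllmo`).
BSD is not proved by this. [cite: AbbesUllmo1996, Thm. A] [cite: Buzzard2000LevelLoweringModTwo, Prop. 2.4] [cite: Pollack2003, Conj. 6.3] -/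
theorem mazurTateCongruenceAtTwoTop_of_fiveFacts_cuspSpan
    (hES : eichlerShimura_depletedOptimalQuotient_periodLattice_of_dvd) (hSD : heckeSelfDual_torsionBy_J0)
    (hBz : buzzard2000_multiplicityOne_gamma0) (hSe : serre1972_supersingular_decompositionSubgroup_image)
    (hAU : abbesUllmo_not_dvd_maninConstant_of_not_dvd_level)
    (hG : ∀ (N : ℕ) [NeZero N], ¬ 2 ∣ N → SignedMuAtTwo.CuspSpanEvenAtTwo N) :
    Summit.BirchSwinnertonDyer.BirchSwinnertonDyer.Theses.ThetaPartnerAtTwo.MazurTateCongruenceAtTwoTop :=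
  mazurTateCongruenceAtTwoTop_of_fourFacts_cuspSpan hES hSD hBz hSe
    (SkinnerUrban2014.realPeriodRat_eq_unit_mul_plusPeriod_two_fact_of_abbesUllmo hAU) hG

/-- The same with Hecke self-duality DERIVED from the integral intersection pairing (`heckeSelfDual_torsionBy_J0_of_perfectPairing`):
{ES-depleted, integral pairing, Bz, Se, AU} + the node. BSD is not proved by this. [cite: DarmonDiamondTaylor1995, §1.6 Lemma 1.38]
[cite: AbbesUllmo1996, Thm. A] [cite: Pollack2003, Conj. 6.3] -/
theorem mazurTateCongruenceAtTwoTop_of_fiveFacts_pairing_cuspSpan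
    (hES : eichlerShimura_depletedOptimalQuotient_periodLattice_of_dvd)
    (hpair : periodHomology_exists_heckeSelfAdjoint_perfectPairing)
    (hBz : buzzard2000_multiplicityOne_gamma0) (hSe : serre1972_supersingular_decompositionSubgroup_image)
    (hAU : abbesUllmo_not_dvd_maninConstant_of_not_dvd_level)
    (hG : ∀ (N : ℕ) [NeZero N], ¬ 2 ∣ N → SignedMuAtTwo.CuspSpanEvenAtTwo N) :
    Summit.BirchSwinnertonDyer.BirchSwinnertonDyer.Theses.ThetaPartnerAtTwo.MazurTateCongruenceAtTwoTop :=
  mazurTateCongruenceAtTwoTop_of_fiveFacts_cuspSpan hES (heckeSelfDual_torsionBy_J0_of_perfectPairing hpair) hBz hSe hAU hG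

/-- **THE CRUX BY NAME behind FOUR print facts + the period fact + «(PR₂) for every GoodSS-`2`/`a₂ = 0` curve»** (per-curve `μ`-statement,
weaker than `CuspSpanEvenAtTwo` at all odd levels). BSD is not proved by this. [cite: PollackWeston2011MT, Rem. 4.2.1]
[cite: GreenbergVatsal2000, Thm. (1.4), §3 (13)] -/
theorem mazurTateCongruenceAtTwoTop_of_fourFacts_undepletedMax
    (hES : eichlerShimura_depletedOptimalQuotient_periodLattice_of_dvd) (hSD : heckeSelfDual_torsionBy_J0)
    (hBz : buzzard2000_multiplicityOne_gamma0) (hSe : serre1972_supersingular_decompositionSubgroup_image)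
    (h2 : realPeriodRat_eq_unit_mul_plusPeriod_two)
    (hPR : ∀ (E : WeierstrassCurve ℚ) [E.IsElliptic] [E.IsGloballyMinimal], GoodSS E 2 → E.frobeniusTrace 2 = 0 →
      ∀ [NeZero (E.conductorNorm ℤ)] (f : CuspForm (Gamma0 (E.conductorNorm ℤ)) 2), IsNewformOf E f →
      ∃ n₁ : ℕ, Even n₁ ∧ ∃ s : ZMod (2 ^ n₁), ∀ r : ℚ, ‖algebraMap ℚ (PadicAlgCl 2) (ratPlusSymbol f r)‖ ≤
        ‖algebraMap ℚ (PadicAlgCl 2) (ratPlusSymbol f ((((cyclotomicGenerator 2 : ZMod (2 ^ (n₁ + 2))) ^ s.val).val : ℚ) / (2 : ℚ) ^ (n₁ + 2)))‖) :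
    Summit.BirchSwinnertonDyer.BirchSwinnertonDyer.Theses.ThetaPartnerAtTwo.MazurTateCongruenceAtTwoTop :=
  mazurTateCongruenceAtTwoTop_of_fourFacts_mu hES hSD hBz hSe
    fun E _ _ hss ha _ f hf _ hϖ S₀ hS2 _ ↦ symbolMu_of_undepletedMax E h2 hss ha hf hϖ S₀ hS2 (hPR E hss ha f hf)

/-- **THE CRUX BY NAME behind FOUR print facts + the period fact + FLAT** («`∃ n, IsUnit (coeff n (kobayashiL 1 L⁺ L⁻))` for every
GoodSS-`2`/`a₂ = 0` curve, newform and Pollack pair» — item 26470's currency, unrestricted). The crux's own binders supply the Pollack pairs.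
BSD is not proved by this. [cite: Pollack2003, Conj. 6.3 and Prop. 6.18] [cite: GreenbergVatsal2000, Thm. (1.4), §3 (13)] -/
theorem mazurTateCongruenceAtTwoTop_of_fourFacts_flat
    (hES : eichlerShimura_depletedOptimalQuotient_periodLattice_of_dvd) (hSD : heckeSelfDual_torsionBy_J0)
    (hBz : buzzard2000_multiplicityOne_gamma0) (hSe : serre1972_supersingular_decompositionSubgroup_image)
    (h2 : realPeriodRat_eq_unit_mul_plusPeriod_two)
    (hFlat : ∀ (E : WeierstrassCurve ℚ) [E.IsElliptic] [E.IsGloballyMinimal], GoodSS E 2 → E.frobeniusTrace 2 = 0 →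
      ∀ [NeZero (E.conductorNorm ℤ)] (f : CuspForm (Gamma0 (E.conductorNorm ℤ)) 2), IsNewformOf E f →
      ∀ (Lplus Lminus : IwasawaAlgebra 2), IsPollackPair f 2 Lplus Lminus →
      ∃ n : ℕ, IsUnit (PowerSeries.coeff n (kobayashiL 1 Lplus Lminus))) :
    Summit.BirchSwinnertonDyer.BirchSwinnertonDyer.Theses.ThetaPartnerAtTwo.MazurTateCongruenceAtTwoTop := by
  intro W _ _ A _ _ _ _ hss ha hAcm hAss hAa he γ _ _ f hf ϖ hϖ Lplus Lminus hPP _ fA hfA ϖA hϖA LplusA LminusA hPPA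
    S₀ hS2 hSW hSA G m hG GA m' hGA
  have hΔ : W.Δ < 0 := by
    obtain ⟨e, he'⟩ := he
    exact ThetaPartnerXRoute.Δ_neg_of_cmPartner_two W A hAcm hAss e he'
  exact mazurTateCongruence_of_plusLine W A (plusLineAtTwoLevel_of_charTwoLevel (plusLineCharTwo_of_fourFacts hES hSD hBz hSe)) hss hΔ
    hAss he f hf ϖ hPP fA hfA ϖA hPPA S₀ hS2 hSW hSA (symbolMu_of_flat W h2 hss ha hf hϖ hPP (hFlat W hss ha f hf Lplus Lminus hPP) S₀ hS2)
    (symbolMu_of_flat A h2 hAss hAa hfA hϖA hPPA (hFlat A hAss hAa fA hfA LplusA LminusA hPPA) S₀ hS2) hG hGA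

/-- **PUB⁵ + FLAT**: the crux BY NAME behind {ES-depleted, SD, Bz, Se, AU} + «analytic `μ♭ = 0` at `2` for every GoodSS-`2`/`a₂ = 0` curve».
BSD is not proved by this. [cite: AbbesUllmo1996, Thm. A] [cite: Pollack2003, Conj. 6.3] -/
theorem mazurTateCongruenceAtTwoTop_of_fiveFacts_flat
    (hES : eichlerShimura_depletedOptimalQuotient_periodLattice_of_dvd) (hSD : heckeSelfDual_torsionBy_J0)
    (hBz : buzzard2000_multiplicityOne_gamma0) (hSe : serre1972_supersingular_decompositionSubgroup_image)
    (hAU : abbesUllmo_not_dvd_maninConstant_of_not_dvd_level)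
    (hFlat : ∀ (E : WeierstrassCurve ℚ) [E.IsElliptic] [E.IsGloballyMinimal], GoodSS E 2 → E.frobeniusTrace 2 = 0 →
      ∀ [NeZero (E.conductorNorm ℤ)] (f : CuspForm (Gamma0 (E.conductorNorm ℤ)) 2), IsNewformOf E f →
      ∀ (Lplus Lminus : IwasawaAlgebra 2), IsPollackPair f 2 Lplus Lminus →
      ∃ n : ℕ, IsUnit (PowerSeries.coeff n (kobayashiL 1 Lplus Lminus))) :
    Summit.BirchSwinnertonDyer.BirchSwinnertonDyer.Theses.ThetaPartnerAtTwo.MazurTateCongruenceAtTwoTop :=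
  mazurTateCongruenceAtTwoTop_of_fourFacts_flat hES hSD hBz hSe
    (SkinnerUrban2014.realPeriodRat_eq_unit_mul_plusPeriod_two_fact_of_abbesUllmo hAU) hFlat

/-- The twin `MazurTateCongruenceAtTwoR` (stmt-21416) BY NAME behind FOUR print facts + the period fact + the node. BSD is not proved by this.
[cite: GreenbergVatsal2000, Thm. (1.4), §3 (13)] [cite: Pollack2003, Conj. 6.3] -/
theorem mazurTateCongruenceAtTwoR_of_fourFacts_cuspSpan
    (hES : eichlerShimura_depletedOptimalQuotient_periodLattice_of_dvd) (hSD : heckeSelfDual_torsionBy_J0)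
    (hBz : buzzard2000_multiplicityOne_gamma0) (hSe : serre1972_supersingular_decompositionSubgroup_image)
    (h2 : realPeriodRat_eq_unit_mul_plusPeriod_two)
    (hG : ∀ (N : ℕ) [NeZero N], ¬ 2 ∣ N → SignedMuAtTwo.CuspSpanEvenAtTwo N) :
    Summit.BirchSwinnertonDyer.BirchSwinnertonDyer.Theses.ThetaPartnerAtTwo.MazurTateCongruenceAtTwoR :=
  mazurTateCongruenceAtTwoTop_of_fourFacts_cuspSpan hES hSD hBz hSe h2 hG

/-- The twin `MazurTateCongruenceAtTwoR` (stmt-21416) BY NAME behind PUB⁵ + the node. BSD is not proved by this.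
[cite: AbbesUllmo1996, Thm. A] [cite: Pollack2003, Conj. 6.3] -/
theorem mazurTateCongruenceAtTwoR_of_fiveFacts_cuspSpan
    (hES : eichlerShimura_depletedOptimalQuotient_periodLattice_of_dvd) (hSD : heckeSelfDual_torsionBy_J0)
    (hBz : buzzard2000_multiplicityOne_gamma0) (hSe : serre1972_supersingular_decompositionSubgroup_image)
    (hAU : abbesUllmo_not_dvd_maninConstant_of_not_dvd_level)
    (hG : ∀ (N : ℕ) [NeZero N], ¬ 2 ∣ N → SignedMuAtTwo.CuspSpanEvenAtTwo N) :
    Summit.BirchSwinnertonDyer.BirchSwinnertonDyer.Theses.ThetaPartnerAtTwo.MazurTateCongruenceAtTwoR :=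
  mazurTateCongruenceAtTwoTop_of_fiveFacts_cuspSpan hES hSD hBz hSe hAU hG

end Crux

end Summit.BirchSwinnertonDyer.BirchSwinnertonDyer.Theorems.MazurTateCongruenceAtTwoR

end
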